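import Literature.AlgebraicGeometry.AbelianSchemes.PolarizationClausesOfThickening
import HarnessLib

/-!
# The symplectic-liftability clause of a level structure, point by point of the base
# ([Lan2013PELCompactifications] Lemma 1.3.6.6 / Cor. 1.3.6.7: «symplectic-liftable iff symplectic-liftable at every geometric point»)

Layer `Literature/AlgebraicGeometry/AbelianSchemes`, namespace `Literature.AlgebraicGeometry.AbelianSchemes.AbelianSchemeOver`.
THEOREMS ONLY (no definition, no named fact, no instance, no notation, no `sorry`).  Cell `hodgecm-mathlib` (D-0151),
F-DAG F-10 (b) «classify for `M/Γ`», cut (b4) «the symplectic class of a level structure is locally constant» (sub-hand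
B-p02 (g13) under B-p06 (g11)'s (b) lead; B-plan1 (g15) 05:20:18Z), FILE A = the half that does NOT depend on the (h9-S)
W3 transport: the symplectic twin of §1 of ★ `PolarizationTypeLocus`.  Count-neutral capital; HC_CM is proved only modulo
the 7 printed citations until rung 0 closes — nothing here is about HC.

The clause.  For a level-`N` structure `φ` on an abelian scheme `A/S`, a polarisation `pol` and a type `δ`, ★
`LevelStructure.IsSymplecticLiftable φ pol δ` ([Lan2013PELCompactifications] Def. 1.3.6.2 through the pointwise criterion
Lemma 1.3.6.6 / Cor. 1.3.6.7) asks, at EVERY geometric point `s : Spec Ω → S` and for EVERY ample witness `Θ` of the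
polarisation there, for a symplectic lift `φ.SymplecticLift s Θ δ`.  Read at a point `x` of the underlying space of `S`
this is the POINTWISE CLAUSE

  `Lift(x)` :≡ `∀ Ω (s : Spec Ω → S) over x, ∀ Θ ample with λ̄_s = Λ(𝒪(Θ)), Nonempty (φ.SymplecticLift s Θ δ)`

(written inline below, never as a definition), and `φ.IsSymplecticLiftable pol δ ↔ ∀ x, Lift(x)`
(`isSymplecticLiftable_iff_forall_base`).  What is proved:

* §1 single-lift transports at a point `t` of a base change `g : S′ → S` along the fibre identification
  `e : (A ×_S S′)_t ≅ A_{t ≫ g}` (★ `fibreBaseChangeIso`): `SymplecticLift.nonempty_baseChange` (a lift of `φ` at `t ≫ g`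
  for `Θ` gives one of `φ ×_S S′` at `t` for `e^*Θ`) and `SymplecticLift.nonempty_of_baseChange` (a lift of `φ ×_S S′` at
  `t` for `Θ′` gives one of `φ` at `t ≫ g` for `(e⁻¹)^*Θ′`) — ★ (T1) `SymplecticLift.nonempty_transport` with the section
  junction ★ `map_fibreBaseChangeIso_restrictPt_baseChange_σ`;
* §2 the clause of `φ ×_S S′` at the geometric point `t` ⟺ the clause of `φ` at the geometric point `t ≫ g`
  (`forall_nonempty_symplecticLift_baseChange_iff`; witnesses move by ★ `IsLambdaOfAt.baseChange` /
  ★ `IsLambdaOfAt.of_baseChange`, classes by ★ (T0) `SymplecticLift.nonempty_of_linEquiv`);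
* §3 the locus bookkeeping the consumer (b4) reads: `IsSymplecticLiftable.baseChange_of_forall_mem_range` — if `Lift(x)`
  holds at every `x` in the set-theoretic image of `g` then `φ ×_S S′` IS symplectic-liftable for `λ ×_S S′` («restrict the
  tautological level structure to the liftable locus and it is symplectic-liftable there»); for an open `U ⊆ S` the
  converse holds too: `isSymplecticLiftable_baseChange_ι_iff : (φ ×_S U) liftable ↔ ∀ x ∈ U, Lift(x)`.

FILE B (`LevelStructureSymplecticClassLocusClopen`, after the (h9-S) head «liftable at ONE geometric point of a connected
base ⇒ liftable») adds the spreading over connected components and `IsClopen {x | Lift(x)}` — the literal F-6 (V′)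
symplectic socket, twin of ★ `Polarization.isClopen_setOf_forall_exists_mulHom_of_isLocallyNoetherian`.

## References
* [Lan2013PELCompactifications] K.-W. Lan, *Arithmetic compactifications of PEL-type Shimura varieties*, LMS Monographs 36
  (2013), §1.3.6 Def. 1.3.6.2 (p. 80), Lemma 1.3.6.5 (p. 81), Lemma 1.3.6.6 and Cor. 1.3.6.7 (pp. 81–82).
* [MumfordFogartyKirwan1994] D. Mumford, J. Fogarty, F. Kirwan, *Geometric Invariant Theory*, 3rd ed. (1994), Ch. 7 §2
  Definition 7.2 (p. 129): the moduli functor is a functor «in the obvious way» (by pull-back).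
* [MumfordAV1970] D. Mumford, *Abelian Varieties* (1970), §20, property (3) of `e_n` (p. 186).
* Tree: ★ `AbelianSchemeSymplecticLevel` (`SymplecticLift`, `IsSymplecticLiftable`), ★ `AbelianSchemeSymplecticLevelTransfer`
  (T0/T1/T2), ★ `AbelianSchemeIsLambdaOfAtBaseChange` (`fibreBaseChangeIso`, `divisorBaseChange`, `IsLambdaOfAt.baseChange`,
  `IsLambdaOfAt.of_baseChange`), ★ `PolarizedAbelianSchemeWithLevelBaseChange` (`map_fibreBaseChangeIso_restrictPt_baseChange_σ`),
  ★ `AbelianSchemePolarizationBaseChange` (`Polarization.baseChange`), ★ `PolarizationClausesOfThickening`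
  (`IsSymplecticLiftable.baseChange`).
-/

noncomputable section

universe u

open CategoryTheory CategoryTheory.Limits AlgebraicGeometry

namespace Literature.AlgebraicGeometry.AbelianSchemes

namespace AbelianSchemeOver

open Literature.AlgebraicGeometry.Motives
open scoped MonObj

variable {S S' : Scheme.{u}} (A : AbelianSchemeOver S) (g : S' ⟶ S) {D : A.DualPair} (pol : A.Polarization D)
  {g₀ N : ℕ} (φ : A.LevelStructure g₀ N) (δ : Fin g₀ → ℕ)

/-! ### §1 Single symplectic lifts across the fibre identification of a base change -/

/-- **A symplectic lift of `φ` at the geometric point `t ≫ g` for the witness `Θ` yields a symplectic lift of `φ ×_S S′` at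
`t` for `e^*Θ`**, `e : (A ×_S S′)_t ≅ A_{t ≫ g}` the fibre identification (★ `fibreBaseChangeIso`, `e^*Θ =` ★
`divisorBaseChange`): ★ (T1) `SymplecticLift.nonempty_transport` along `e`, the sections of `φ ×_S S′` at `t` being carried
to those of `φ` at `t ≫ g` (★ `map_fibreBaseChangeIso_restrictPt_baseChange_σ`).  [Lan] Lemma 1.3.6.5 is a statement about
the geometric fibre, which `e` identifies. [cite: Lan2013PELCompactifications, §1.3.6 Lemma 1.3.6.5 (p. 81)]
[cite: MumfordAV1970, §20 (property (3) of e_n, p. 186)] -/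
theorem LevelStructure.SymplecticLift.nonempty_baseChange {Ω : Type u} [Field Ω] (t : Spec (.of Ω) ⟶ S')
    {Θ : CartierDivisor (A.fibre (t ≫ g)).toAbelianVariety.X.left} (Λ : φ.SymplecticLift (t ≫ g) Θ δ) :
    Nonempty ((φ.baseChange g).SymplecticLift t (A.divisorBaseChange g t Θ) δ) := by
  haveI := A.isIso_toSchemeHom_fibreBaseChangeIso g t
  exact Λ.nonempty_transport (φ' := φ.baseChange g) (A.fibreBaseChangeIso g t)
    (fun j => LevelStructure.map_fibreBaseChangeIso_restrictPt_baseChange_σ A g φ t j)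

/-- **A symplectic lift of `φ ×_S S′` at the geometric point `t` for the witness `Θ′` yields a symplectic lift of `φ` at
`t ≫ g` for `(e⁻¹)^*Θ′`** — ★ (T1) along `e⁻¹`, the sections matched through ★ `map_fibreBaseChangeIso_restrictPt_baseChange_σ`
read backwards (`e⁻¹(e(σ′ⱼ(t))) = σ′ⱼ(t)`). [cite: Lan2013PELCompactifications, §1.3.6 Lemma 1.3.6.5 (p. 81)]
[cite: MumfordAV1970, §20 (property (3) of e_n, p. 186)] -/
theorem LevelStructure.SymplecticLift.nonempty_of_baseChange {Ω : Type u} [Field Ω] (t : Spec (.of Ω) ⟶ S')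
    {Θ' : CartierDivisor ((A.baseChange g).fibre t).toAbelianVariety.X.left}
    (Λ' : (φ.baseChange g).SymplecticLift t Θ' δ) :
    haveI : IsDominant (AbelianVariety.Hom.toSchemeHom (A.fibreBaseChangeIso g t).inv) :=
      AbelianVariety.isDominant_toSchemeHom_iso_hom (A.fibreBaseChangeIso g t).symm
    Nonempty (φ.SymplecticLift (t ≫ g)
      (Θ'.pullback (AbelianVariety.Hom.toSchemeHom (A.fibreBaseChangeIso g t).inv)) δ) := by
  haveI : IsDominant (AbelianVariety.Hom.toSchemeHom (A.fibreBaseChangeIso g t).inv) :=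
    AbelianVariety.isDominant_toSchemeHom_iso_hom (A.fibreBaseChangeIso g t).symm
  have he : ∀ j : Fin g₀ ⊕ Fin g₀,
      AlgPoints.map (A.fibreBaseChangeIso g t).symm.hom.hom.hom.hom (A.restrictPt (t ≫ g) (φ.σ j)) =
        (A.baseChange g).restrictPt t ((φ.baseChange g).σ j) := fun j => by
    rw [← LevelStructure.map_fibreBaseChangeIso_restrictPt_baseChange_σ A g φ t j]
    exact (A.fibrePointsMulEquiv g t).symm_apply_apply _
  exact Λ'.nonempty_transport (A.fibreBaseChangeIso g t).symm he

/-! ### §2 The pointwise clause across a base change -/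

/-- **If the clause holds for `φ` at the geometric point `t ≫ g`, it holds for `φ ×_S S′` at `t`**: an ample witness `Θ′`
of `λ̄ ×_S S′ = Λ(𝒪(Θ′))` at `t` gives the ample witness `(e⁻¹)^*Θ′` of `λ̄` at `t ≫ g` (★ `IsLambdaOfAt.of_baseChange`, ★
`IsAmple.pullback`); lift there; carry the lift to `t` (§1) as a lift for `e^*(e⁻¹)^*Θ′`, the same divisor as `Θ′`
(★ (T0) `SymplecticLift.nonempty_of_linEquiv`). [cite: Lan2013PELCompactifications, §1.3.6 Lemma 1.3.6.6 and Cor. 1.3.6.7 (pp. 81–82)]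
[cite: MumfordFogartyKirwan1994, Ch. 7 §2 Definition 7.2 (p. 129)] -/
theorem LevelStructure.nonempty_symplecticLift_baseChange_of_forall {Ω : Type u} [Field Ω] (t : Spec (.of Ω) ⟶ S')
    (h : ∀ Θ : CartierDivisor (A.fibre (t ≫ g)).toAbelianVariety.X.left, Θ.IsAmple →
      A.IsLambdaOfAt (t ≫ g) D pol.lam Θ → Nonempty (φ.SymplecticLift (t ≫ g) Θ δ))
    {Θ' : CartierDivisor ((A.baseChange g).fibre t).toAbelianVariety.X.left} (hΘ' : Θ'.IsAmple)
    (hlam' : (A.baseChange g).IsLambdaOfAt t (D.baseChange g) (pol.baseChange g).lam Θ') :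
    Nonempty ((φ.baseChange g).SymplecticLift t Θ' δ) := by
  haveI := A.isIso_toSchemeHom_fibreBaseChangeIso g t
  haveI := A.isIso_toSchemeHom_fibreBaseChangeIso_inv g t
  haveI h₂ : IsDominant (AbelianVariety.Hom.toSchemeHom (A.fibreBaseChangeIso g t).inv) :=
    AbelianVariety.isDominant_toSchemeHom_iso_hom (A.fibreBaseChangeIso g t).symm
  -- the witness `(e⁻¹)^*Θ′` at `t ≫ g`
  have hΘ : (Θ'.pullback (AbelianVariety.Hom.toSchemeHom (A.fibreBaseChangeIso g t).inv)).IsAmple := hΘ'.pullback _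
  have hlam : A.IsLambdaOfAt (t ≫ g) D pol.lam
      (Θ'.pullback (AbelianVariety.Hom.toSchemeHom (A.fibreBaseChangeIso g t).inv)) :=
    IsLambdaOfAt.of_baseChange A g D t pol.lam Θ' hlam'
  obtain ⟨Λ⟩ := h _ hΘ hlam
  obtain ⟨Λ'⟩ := Λ.nonempty_baseChange A g φ δ t
  -- `e^* (e⁻¹)^* Θ′` is the same divisor as `Θ′`
  have hsame : (A.divisorBaseChange g t
      (Θ'.pullback (AbelianVariety.Hom.toSchemeHom (A.fibreBaseChangeIso g t).inv))).SameDivisor Θ' :=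
    ((Θ'.pullback_pullback_sameDivisor _ _).trans
      (Θ'.pullback_congr_sameDivisor (A.toSchemeHom_fibreBaseChangeIso_hom_comp_inv g t))).trans
      Θ'.pullback_id_sameDivisor
  exact Λ'.nonempty_of_linEquiv hsame.linEquiv

/-- **If the clause holds for `φ ×_S S′` at the geometric point `t`, it holds for `φ` at `t ≫ g`**: an ample witness `Θ`
of `λ̄` at `t ≫ g` gives the ample witness `e^*Θ` of `λ̄ ×_S S′` at `t` (★ `IsLambdaOfAt.baseChange`); lift there; carry the
lift back to `t ≫ g` (§1) as a lift for `(e⁻¹)^*e^*Θ`, the same divisor as `Θ` (★ (T0)).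
[cite: Lan2013PELCompactifications, §1.3.6 Lemma 1.3.6.6 and Cor. 1.3.6.7 (pp. 81–82)]
[cite: MumfordFogartyKirwan1994, Ch. 7 §2 Definition 7.2 (p. 129)] -/
theorem LevelStructure.nonempty_symplecticLift_of_forall_baseChange {Ω : Type u} [Field Ω] (t : Spec (.of Ω) ⟶ S')
    (h' : ∀ Θ' : CartierDivisor ((A.baseChange g).fibre t).toAbelianVariety.X.left, Θ'.IsAmple →
      (A.baseChange g).IsLambdaOfAt t (D.baseChange g) (pol.baseChange g).lam Θ' →
        Nonempty ((φ.baseChange g).SymplecticLift t Θ' δ))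
    {Θ : CartierDivisor (A.fibre (t ≫ g)).toAbelianVariety.X.left} (hΘ : Θ.IsAmple)
    (hlam : A.IsLambdaOfAt (t ≫ g) D pol.lam Θ) :
    Nonempty (φ.SymplecticLift (t ≫ g) Θ δ) := by
  haveI := A.isIso_toSchemeHom_fibreBaseChangeIso g t
  haveI := A.isIso_toSchemeHom_fibreBaseChangeIso_inv g t
  haveI h₂ : IsDominant (AbelianVariety.Hom.toSchemeHom (A.fibreBaseChangeIso g t).inv) :=
    AbelianVariety.isDominant_toSchemeHom_iso_hom (A.fibreBaseChangeIso g t).symm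
  -- the witness `e^*Θ` at `t`
  have hΘ₀ : (A.divisorBaseChange g t Θ).IsAmple := hΘ.pullback _
  have hlam₀ : (A.baseChange g).IsLambdaOfAt t (D.baseChange g) (pol.baseChange g).lam (A.divisorBaseChange g t Θ) :=
    IsLambdaOfAt.baseChange A g D t pol.lam Θ hlam
  obtain ⟨Λ₀⟩ := h' _ hΘ₀ hlam₀
  obtain ⟨Λ⟩ := Λ₀.nonempty_of_baseChange A g φ δ t
  -- `(e⁻¹)^* e^* Θ` is the same divisor as `Θ`
  have hsame : ((A.divisorBaseChange g t Θ).pullback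
      (AbelianVariety.Hom.toSchemeHom (A.fibreBaseChangeIso g t).inv)).SameDivisor Θ :=
    ((Θ.pullback_pullback_sameDivisor _ _).trans
      (Θ.pullback_congr_sameDivisor (A.toSchemeHom_fibreBaseChangeIso_inv_comp_hom g t))).trans
      Θ.pullback_id_sameDivisor
  exact Λ.nonempty_of_linEquiv hsame.linEquiv

/-- **The clause of `φ ×_S S′` at the geometric point `t` ⟺ the clause of `φ` at the geometric point `t ≫ g`** —
[Lan2013PELCompactifications] Lemma 1.3.6.5 / 1.3.6.6 test symplectic-liftability on the geometric fibre, which the base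
change does not change. [cite: Lan2013PELCompactifications, §1.3.6 Lemma 1.3.6.6 and Cor. 1.3.6.7 (pp. 81–82)]
[cite: MumfordFogartyKirwan1994, Ch. 7 §2 Definition 7.2 (p. 129)] -/
theorem LevelStructure.forall_nonempty_symplecticLift_baseChange_iff {Ω : Type u} [Field Ω] (t : Spec (.of Ω) ⟶ S') :
    (∀ Θ' : CartierDivisor ((A.baseChange g).fibre t).toAbelianVariety.X.left, Θ'.IsAmple →
      (A.baseChange g).IsLambdaOfAt t (D.baseChange g) (pol.baseChange g).lam Θ' →
        Nonempty ((φ.baseChange g).SymplecticLift t Θ' δ)) ↔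
    ∀ Θ : CartierDivisor (A.fibre (t ≫ g)).toAbelianVariety.X.left, Θ.IsAmple →
      A.IsLambdaOfAt (t ≫ g) D pol.lam Θ → Nonempty (φ.SymplecticLift (t ≫ g) Θ δ) :=
  ⟨fun h' _ hΘ hlam => LevelStructure.nonempty_symplecticLift_of_forall_baseChange A g pol φ δ t h' hΘ hlam,
    fun h _ hΘ' hlam' => LevelStructure.nonempty_symplecticLift_baseChange_of_forall A g pol φ δ t h hΘ' hlam'⟩

/-! ### §3 The liftable locus: bookkeeping for the consumer -/

/-- `φ` is symplectic-liftable of type `δ` for `pol` iff the pointwise clause `Lift(x)` holds at every point `x` of the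
base ([Lan2013PELCompactifications] Cor. 1.3.6.7: «it suffices to verify the statements over each geometric point»; the
definition ★ `IsSymplecticLiftable` regrouped by the image point). [cite: Lan2013PELCompactifications, §1.3.6 Lemma 1.3.6.6 and Cor. 1.3.6.7 (pp. 81–82)] -/
theorem LevelStructure.isSymplecticLiftable_iff_forall_base :
    φ.IsSymplecticLiftable pol δ ↔
      ∀ (x : S) (Ω : Type u) [Field Ω] [IsAlgClosed Ω] (s : Spec (.of Ω) ⟶ S),
        s.base (IsLocalRing.closedPoint Ω) = x →
        ∀ Θ : CartierDivisor (A.fibre s).toAbelianVariety.X.left, Θ.IsAmple → A.IsLambdaOfAt s D pol.lam Θ →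
          Nonempty (φ.SymplecticLift s Θ δ) :=
  ⟨fun h _ Ω _ _ s _ Θ hΘ hlam => h Ω s Θ hΘ hlam, fun h Ω _ _ s Θ hΘ hlam => h _ Ω s rfl Θ hΘ hlam⟩

/-- **If the pointwise clause `Lift(x)` holds at every point `x` of the set-theoretic image of `g : S′ → S`, then
`φ ×_S S′` is symplectic-liftable of type `δ` for `λ ×_S S′`** (every geometric point `t` of `S′` lies over
`g(t) ∈ g(S′)`; §2).  The (b4) consumer shape: restricting the tautological level structure of a cover to the liftable locus
makes it symplectic-liftable. [cite: Lan2013PELCompactifications, §1.3.6 Lemma 1.3.6.6 and Cor. 1.3.6.7 (pp. 81–82)]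
[cite: MumfordFogartyKirwan1994, Ch. 7 §2 Definition 7.2 (p. 129)] -/
theorem LevelStructure.IsSymplecticLiftable.baseChange_of_forall_mem_range
    (h : ∀ x ∈ Set.range g.base, ∀ (Ω : Type u) [Field Ω] [IsAlgClosed Ω] (s : Spec (.of Ω) ⟶ S),
      s.base (IsLocalRing.closedPoint Ω) = x →
      ∀ Θ : CartierDivisor (A.fibre s).toAbelianVariety.X.left, Θ.IsAmple → A.IsLambdaOfAt s D pol.lam Θ →
        Nonempty (φ.SymplecticLift s Θ δ)) :
    (φ.baseChange g).IsSymplecticLiftable (pol.baseChange g) δ := by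
  intro Ω _ _ t Θ' hΘ' hlam'
  refine LevelStructure.nonempty_symplecticLift_baseChange_of_forall A g pol φ δ t
    (fun Θ hΘ hlam => h _ ⟨t.base (IsLocalRing.closedPoint Ω), ?_⟩ Ω (t ≫ g) rfl Θ hΘ hlam) hΘ' hlam'
  rw [Scheme.Hom.comp_apply]

/-- A geometric point whose image lies in an open `U ⊆ S` factors through the open subscheme `U`. [folklore] -/
private theorem exists_lift_of_mem_opens (U : S.Opens) {Ω : Type u} [Field Ω] (s : Spec (.of Ω) ⟶ S)
    (hs : s.base (IsLocalRing.closedPoint Ω) ∈ U) : ∃ s' : Spec (.of Ω) ⟶ (U : Scheme.{u}), s' ≫ U.ι = s := by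
  have hr : Set.range s.base ⊆ Set.range U.ι.base := by
    rintro _ ⟨p, rfl⟩
    rw [Scheme.Opens.range_ι, Subsingleton.elim p (IsLocalRing.closedPoint Ω)]
    exact hs
  exact ⟨IsOpenImmersion.lift U.ι s hr, IsOpenImmersion.lift_fac U.ι s hr⟩

/-- **On an open subscheme `U ⊆ S`: `φ ×_S U` is symplectic-liftable of type `δ` for `λ ×_S U` iff the pointwise clause
`Lift(x)` holds at every `x ∈ U`** — a geometric point of `S` over `x ∈ U` factors through the open subscheme `U`, so
§2 applies in both directions. [cite: Lan2013PELCompactifications, §1.3.6 Lemma 1.3.6.6 and Cor. 1.3.6.7 (pp. 81–82)] -/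
theorem LevelStructure.isSymplecticLiftable_baseChange_ι_iff (U : S.Opens) :
    (φ.baseChange U.ι).IsSymplecticLiftable (pol.baseChange U.ι) δ ↔
      ∀ x ∈ U, ∀ (Ω : Type u) [Field Ω] [IsAlgClosed Ω] (s : Spec (.of Ω) ⟶ S),
        s.base (IsLocalRing.closedPoint Ω) = x →
        ∀ Θ : CartierDivisor (A.fibre s).toAbelianVariety.X.left, Θ.IsAmple → A.IsLambdaOfAt s D pol.lam Θ →
          Nonempty (φ.SymplecticLift s Θ δ) := by
  constructor
  · intro h x hx Ω _ _ s hs Θ hΘ hlam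
    obtain ⟨s', rfl⟩ := exists_lift_of_mem_opens U s (hs ▸ hx)
    exact LevelStructure.nonempty_symplecticLift_of_forall_baseChange A U.ι pol φ δ s'
      (fun Θ' hΘ' hlam' => h Ω s' Θ' hΘ' hlam') hΘ hlam
  · intro h
    refine LevelStructure.IsSymplecticLiftable.baseChange_of_forall_mem_range A U.ι pol φ δ fun x hx => h x ?_
    rwa [Scheme.Opens.range_ι] at hx

/-- **Symplectic-liftability is inherited by every open subscheme of the base** (`φ ×_S U` for `λ ×_S U`; the special case
`g = U.ι` of ★ `IsSymplecticLiftable.baseChange`, recorded next to its converse-on-points above).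
[cite: Lan2013PELCompactifications, §1.3.6 Lemma 1.3.6.6 and Cor. 1.3.6.7 (pp. 81–82)] -/
theorem LevelStructure.IsSymplecticLiftable.baseChange_ι (U : S.Opens) (h : φ.IsSymplecticLiftable pol δ) :
    (φ.baseChange U.ι).IsSymplecticLiftable (pol.baseChange U.ι) δ :=
  LevelStructure.IsSymplecticLiftable.baseChange A pol φ δ U.ι h

end AbelianSchemeOver

end Literature.AlgebraicGeometry.AbelianSchemes

end
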